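import Summits.QuantumFields.BalabanUV.T4Continuum.Spine.NE7.QLaBlockAvgOneStep
import Summits.QuantumFields.BalabanUV.T4Continuum.Spine.NE7.QLaBlockAvgFederbushEML

/-!
# Spine/NE7/QLaBlockAvgTwoLevel — THE FRAMED ONE-STEP ESTIMATE for the TWO-LEVEL printed prescription (0.10)–(0.12) of [Balaban1987RG1]
# (`BlockAveragingTwoLevel.blockAvg₂ federbushSU expMeanLogSU`, the second disjunct `IsPrintedAveraged₂` of the headline's class), per coarse bond

Cell `pub-balaban-gaps` (YM blitz Y1, track G2, seat `ne7`, generation 8); text of record `run/shared/lean/pub/pub-balaban-gaps/ne/NE7.md` v8,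
census row R55.  The two-level twin of `QLaBlockAvgOneStep`: the loop variables of (0.12) are the four-factor products
`U(c₋,x)·U([x,x′])·U(x′,c₊)·U(c)⁻¹` with the INNER group average `U(y,x) = M({U(Γ)}_{Γ∈G(y,x)})` = Federbush's implicit mean (0.10)
(`federbushSU`; to second order in the mass-linear form by `QLaBlockAvgFederbushEML`), and the OUTER small-loop average over `x ∈ B(c₋)` is
the printed `exp[mean log]` (`expMeanLogSU`).  Frames: the `expMeanLogSU`-mean over `(x, Γ)` of the staircase transporters, as in the
one-level file.  THIS FILE: indices, linear parts, masses, the inner factors to second order (`cVar_estimates`, `cVarRev_estimates`,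
`seg_estimates`, `axInv_estimates`) and the loop variable of (0.12) to second order (`loopHol₂_estimates`:
‖W_r − 1 − loopLin₂(c,r)‖ ≤ 366·|S_d|·ℓρ·loopRem₂(c,r)); the correction factor, the frames and the framed average are the business of the
sequel `QLaBlockAvgTwoLevelFramed`, the sum over coarse bonds and the tower of `QLaBlockAvgTwoLevelContraction`.

HONEST FRAMING.  Elementary one-point second-order bookkeeping on OUR sup-ball domains (flat reference only); NOT NE1a-STEP; nothing of
Bałaban's Props 3–5 or of (1.100).  (QL-a) NOT IN PRINT; NE7 NOT proved; spine 0∕9; fixed finite T⁴ — NOT ℝ⁴, NOT infinite volume, NOT a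
mass gap, NOT Clay.
-/

noncomputable section

open Finset
open scoped BigOperators Matrix Matrix.Norms.L2Operator

namespace Summit.QuantumFields.BalabanUV.T4Continuum.Spine.NE7

open Literature.MathematicalPhysics.QuantumFieldTheory.Balaban1983to89
open Literature.MathematicalPhysics.QuantumFieldTheory.Balaban1983to89.T4Continuum
open Literature.MathematicalPhysics.QuantumFieldTheory.Balaban1983to89.T4AvgSensitivity
open Literature.MathematicalPhysics.QuantumFieldTheory.Balaban1983to89.T4AvgDerivBound
open Literature.MathematicalPhysics.QuantumFieldTheory.Balaban1983to89.BlockAveraging (Idx off loopHol blockOf_src_of_mem_walk)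
open Literature.MathematicalPhysics.QuantumFieldTheory.Balaban1983to89.BlockAveragingTwoLevel (Pt stairHol cVar cVarRev seg loopHol₂
  Small₂ corr₂ avgFun₂ blockAvg₂ blockAvg₂_avg)
open Literature.MathematicalPhysics.QuantumFieldTheory.Balaban1983to89.AveragingRT (axialAvg)
open ExpMeanLog FederbushMean

section SUN

variable {n : Type*} [Fintype n] [DecidableEq n] [Nonempty n]
variable {P : Params} {j : ℕ}

/-! ## §1 Indices, frames, the framed two-level map -/

/-- The index set `(x, Γ)` of the frame: block points by offset and orderings of the axes. [folklore] -/
abbrev PI (P : Params) : Type := Pt P × Equiv.Perm (Fin P.d)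

/-- The index set is nonempty. [folklore] -/
instance instNonemptyPI (P : Params) : Nonempty (PI P) := ⟨(fun _ => ⟨0, P.L_pos⟩, 1)⟩

/-- The staircase family at `y` over `(x, Γ)`. [cite: Balaban1987RG1, (0.11) p.253] -/
def stairFam₂ (V : GaugeField P j (Matrix.specialUnitaryGroup n ℂ)) (y : Site P (j + 1)) : PI P → Matrix.specialUnitaryGroup n ℂ :=
  fun p => stairHol V y (off p.1) p.2

/-- THE FRAME of the two-level analysis: the printed small-loop average of the staircase family over `(x, Γ)`. [folklore] -/
def frame₂ (V : GaugeField P j (Matrix.specialUnitaryGroup n ℂ)) (y : Site P (j + 1)) : Matrix.specialUnitaryGroup n ℂ :=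
  (expMeanLogSU (n := n)).avg (stairFam₂ V y)

/-- The frame gauge transformation `y ↦ λ₂(V, y)⁻¹`. [folklore] -/
def frameTransf₂ (V : GaugeField P j (Matrix.specialUnitaryGroup n ℂ)) : GaugeTransf P (j + 1) (Matrix.specialUnitaryGroup n ℂ) :=
  fun y => (frame₂ V y)⁻¹

/-- THE FRAMED TWO-LEVEL AVERAGE `F₂(V) = (Ū)^{λ₂⁻¹}` of the printed prescription (0.12) with `M = federbushSU`, `ℰ = expMeanLogSU`.
[cite: Balaban1987RG1, (0.12) p.254] -/
def framed₂ (V : GaugeField P j (Matrix.specialUnitaryGroup n ℂ)) : GaugeField P (j + 1) (Matrix.specialUnitaryGroup n ℂ) :=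
  GaugeField.gaugeAct (frameTransf₂ V)
    ((blockAvg₂ (P := P) (j := j) (federbushSU (n := n)) (expMeanLogSU (n := n))).avg V)

/-- The framed two-level average at `c` is `λ₂(c₋)⁻¹ · corr₂(c) · U(c) · λ₂(c₊)`. [folklore] -/
theorem framed₂_apply (V : GaugeField P j (Matrix.specialUnitaryGroup n ℂ)) (c : PBond P (j + 1)) :
    framed₂ V c = (frame₂ V c.src)⁻¹ * corr₂ (federbushSU (n := n)) (expMeanLogSU (n := n)) V c * axialAvg V c * frame₂ V c.tgt := by
  simp only [framed₂, frameTransf₂, GaugeField.gaugeAct, blockAvg₂_avg, avgFun₂, inv_inv, mul_assoc]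

/-- `offSite y (off r) = blockSite y r`: the two parametrisations of the block point agree (both are the end of the staircase).
[folklore] -/
theorem offSite_off (y : Site P (j + 1)) (r : Pt P) : offSite y (off r) = Site.blockSite y r := by
  rw [← walkEnd_stairWord y 1 (off r), walkEnd_emb_stairWord]

/-! ## §2 Linear parts and masses -/

/-- The INNER mean of the linearised staircases at `y` for the block point `r` (linear part of `U(y, x)`). [folklore] -/
def permMeanLin (V : GaugeField P j (Matrix.specialUnitaryGroup n ℂ)) (y : Site P (j + 1)) (r : Pt P) : MatA n :=
  ((Fintype.card (Equiv.Perm (Fin P.d)) : ℂ))⁻¹ • ∑ σ, walkLin V (walk (emb y) (stairWord σ (off r)))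

/-- The staircase mean over `(x, Γ)` (linear part of the frame `λ₂`). [folklore] -/
def stairMeanLin₂ (V : GaugeField P j (Matrix.specialUnitaryGroup n ℂ)) (y : Site P (j + 1)) : MatA n :=
  ((Fintype.card (PI P) : ℂ))⁻¹ • ∑ p : PI P, walkLin V (walk (emb y) (stairWord p.2 (off p.1)))

/-- The mean linearised transported bond over the block points (the first-order term). [folklore] -/
def segMeanLin₂ (V : GaugeField P j (Matrix.specialUnitaryGroup n ℂ)) (c : PBond P (j + 1)) : MatA n :=
  ((Fintype.card (Pt P) : ℂ))⁻¹ • ∑ r : Pt P, segLin V c r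

/-- The linear part of the loop variable of (0.12) at `(c, r)`. [folklore] -/
def loopLin₂ (V : GaugeField P j (Matrix.specialUnitaryGroup n ℂ)) (c : PBond P (j + 1)) (r : Pt P) : MatA n :=
  permMeanLin V c.src r + segLin V c r - permMeanLin V c.tgt r - axLin V c

omit [Nonempty n] in
/-- The mean over the block points of the inner staircase means is the staircase mean over `(x, Γ)`. [folklore] -/
theorem mean_permMeanLin (V : GaugeField P j (Matrix.specialUnitaryGroup n ℂ)) (y : Site P (j + 1)) :
    ((Fintype.card (Pt P) : ℂ))⁻¹ • ∑ r : Pt P, permMeanLin V y r = stairMeanLin₂ V y := by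
  unfold permMeanLin stairMeanLin₂
  rw [← Finset.smul_sum, smul_smul, Fintype.sum_prod_type, Fintype.card_prod, Nat.cast_mul, mul_inv]

omit [Nonempty n] in
/-- THE MEAN LINEAR PART, RESOLVED: `|Pt|⁻¹ Σ_r loopLin₂(c, r) = stairMeanLin₂(c₋) + segMeanLin₂(c) − stairMeanLin₂(c₊) − axLin(c)`. [folklore] -/
theorem mean_loopLin₂ (V : GaugeField P j (Matrix.specialUnitaryGroup n ℂ)) (c : PBond P (j + 1)) :
    ((Fintype.card (Pt P) : ℂ))⁻¹ • ∑ r : Pt P, loopLin₂ V c r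
      = stairMeanLin₂ V c.src + segMeanLin₂ V c - stairMeanLin₂ V c.tgt - axLin V c := by
  have hN : (Fintype.card (Pt P) : ℂ) ≠ 0 := Nat.cast_ne_zero.mpr Fintype.card_ne_zero
  simp only [loopLin₂, Finset.sum_sub_distrib, Finset.sum_add_distrib, smul_sub, smul_add, mean_permMeanLin, segMeanLin₂,
    Finset.sum_const, Finset.card_univ]
  rw [← Nat.cast_smul_eq_nsmul ℂ, smul_smul, inv_mul_cancel₀ hN, one_smul]

/-- THE INNER STAIRCASE MASS (a SUM over the orderings) at `(y, r)`. [folklore] -/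
def permMass (V : GaugeField P j (Matrix.specialUnitaryGroup n ℂ)) (y : Site P (j + 1)) (r : Pt P) : ℝ :=
  ∑ σ : Equiv.Perm (Fin P.d), walkMass V (walk (emb y) (stairWord σ (off r)))

/-- The mass of the transported bond at `(c, r)`. [folklore] -/
def segMass₁ (V : GaugeField P j (Matrix.specialUnitaryGroup n ℂ)) (c : PBond P (j + 1)) (r : Pt P) : ℝ :=
  walkMass V (walk (Site.blockSite c.src r) (List.replicate P.L (c.dir, true)))

/-- The remainder mass of the loop variable at `(c, r)`. [folklore] -/
def loopRem₂ (V : GaugeField P j (Matrix.specialUnitaryGroup n ℂ)) (c : PBond P (j + 1)) (r : Pt P) : ℝ :=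
  permMass V c.src r + segMass₁ V c r + permMass V c.tgt r + axMass V c

/-- Masses are non-negative. [folklore] -/
theorem permMass_nonneg (V : GaugeField P j (Matrix.specialUnitaryGroup n ℂ)) (y : Site P (j + 1)) (r : Pt P) : 0 ≤ permMass V y r :=
  Finset.sum_nonneg fun _ _ => walkMass_nonneg V _

/-- Masses are non-negative. [folklore] -/
theorem loopRem₂_nonneg (V : GaugeField P j (Matrix.specialUnitaryGroup n ℂ)) (c : PBond P (j + 1)) (r : Pt P) : 0 ≤ loopRem₂ V c r :=
  add_nonneg (add_nonneg (add_nonneg (permMass_nonneg V _ _) (walkMass_nonneg V _)) (permMass_nonneg V _ _)) (walkMass_nonneg V _)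

/-! ## §3 The inner factors to second order -/

section Factors

variable (V : GaugeField P j (Matrix.specialUnitaryGroup n ℂ)) {ρ : ℝ}

/-- `|S_d| ≥ 1` as a real. [folklore] -/
theorem one_le_cardPerm (P : Params) : (1 : ℝ) ≤ Fintype.card (Equiv.Perm (Fin P.d)) := by
  exact_mod_cast Fintype.card_pos

/-- The inner staircase mass at `(y, r)` is at most `|S_d|·ℓρ`. [folklore] -/
theorem permMass_le (hρ : 0 ≤ ρ) (hV : ∀ b, dist1 (V b) ≤ ρ) (y : Site P (j + 1)) (r : Pt P) :
    permMass V y r ≤ Fintype.card (Equiv.Perm (Fin P.d)) * (ell P * ρ) := by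
  unfold permMass
  calc ∑ σ : Equiv.Perm (Fin P.d), walkMass V (walk (emb y) (stairWord σ (off r)))
      ≤ ∑ _σ : Equiv.Perm (Fin P.d), ell P * ρ := Finset.sum_le_sum fun σ _ => walkMass_stair_le V hρ hV y ⟨r, σ, 1⟩
    _ = Fintype.card (Equiv.Perm (Fin P.d)) * (ell P * ρ) := by rw [Finset.sum_const, Finset.card_univ, nsmul_eq_mul]

/-- THE AVERAGED CONTOUR VARIABLE `U(y, x)` TO SECOND ORDER (Federbush's inner mean): `‖U(y,x) − 1 − permMeanLin‖ ≤ 337ℓρ·permMass` and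
`‖U(y,x) − 1‖ ≤ 3·permMass`, for `2ℓρ < δ_Fed`. [cite: Balaban1987RG1, (0.11) p.253] -/
theorem cVar_estimates (hρ : 0 ≤ ρ) (hV : ∀ b, dist1 (V b) ≤ ρ) (hF : 2 * (ell P * ρ) < deltaFed n) (y : Site P (j + 1)) (r : Pt P) :
    ‖((cVar (federbushSU (n := n)) V y (off r) : Matrix.specialUnitaryGroup n ℂ) : MatA n) - 1 - permMeanLin V y r‖
        ≤ 337 * (ell P * ρ) * permMass V y r ∧
      ‖((cVar (federbushSU (n := n)) V y (off r) : Matrix.specialUnitaryGroup n ℂ) : MatA n) - 1‖ ≤ 3 * permMass V y r := by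
  have hη0 : 0 ≤ ell P * ρ := by positivity
  have hmass : ∀ σ, walkMass V (walk (emb y) (stairWord σ (off r))) ≤ ell P * ρ := fun σ => walkMass_stair_le V hρ hV y ⟨r, σ, 1⟩
  have hW : ∀ σ, dist1 (stairHol V y (off r) σ) ≤ ell P * ρ := fun σ => (dist1_holAt_le_walkMass V _).trans (hmass σ)
  have hE := norm_fedAvg_sub_one_sub_mean_le (stairHol V y (off r)) hF hW
  -- `Σ_σ dist1 ≤ permMass`
  have hdist : ∑ σ, dist1 (stairHol V y (off r) σ) ≤ permMass V y r :=
    Finset.sum_le_sum fun σ _ => dist1_holAt_le_walkMass V _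
  -- the linearisation defect of the family mean
  set c : ℂ := ((Fintype.card (Equiv.Perm (Fin P.d)) : ℂ))⁻¹ with hc
  have hcn : ‖c‖ = (Fintype.card (Equiv.Perm (Fin P.d)) : ℝ)⁻¹ := by rw [hc, norm_inv, Complex.norm_natCast]
  have hcle : (Fintype.card (Equiv.Perm (Fin P.d)) : ℝ)⁻¹ ≤ 1 := inv_le_one_of_one_le₀ (one_le_cardPerm P)
  have hlin : ‖c • ∑ σ, ((((stairHol V y (off r) σ : Matrix.specialUnitaryGroup n ℂ)) : MatA n) - 1) - permMeanLin V y r‖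
      ≤ (ell P * ρ) * permMass V y r := by
    rw [permMeanLin, ← hc, ← smul_sub, ← Finset.sum_sub_distrib, norm_smul, hcn]
    have hs : ‖∑ σ, ((((stairHol V y (off r) σ : Matrix.specialUnitaryGroup n ℂ)) : MatA n) - 1
        - walkLin V (walk (emb y) (stairWord σ (off r))))‖ ≤ (ell P * ρ) * permMass V y r := by
      refine (norm_sum_le _ _).trans ?_
      rw [permMass, Finset.mul_sum]
      refine Finset.sum_le_sum fun σ _ => (norm_hol_sub_one_sub_walkLin_le V _).trans ?_
      rw [pow_two]
      exact mul_le_mul_of_nonneg_right (hmass σ) (walkMass_nonneg V _)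
    calc (Fintype.card (Equiv.Perm (Fin P.d)) : ℝ)⁻¹ * ‖∑ σ, ((((stairHol V y (off r) σ : Matrix.specialUnitaryGroup n ℂ)) : MatA n) - 1
            - walkLin V (walk (emb y) (stairWord σ (off r))))‖
        ≤ 1 * ((ell P * ρ) * permMass V y r) :=
          mul_le_mul hcle hs (norm_nonneg _) zero_le_one
      _ = (ell P * ρ) * permMass V y r := one_mul _
  set Cv : MatA n := ((cVar (federbushSU (n := n)) V y (off r) : Matrix.specialUnitaryGroup n ℂ) : MatA n) with hCv
  set Mn : MatA n := c • ∑ σ, ((((stairHol V y (off r) σ : Matrix.specialUnitaryGroup n ℂ)) : MatA n) - 1) with hMn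
  have hE' : ‖Cv - 1 - Mn‖ ≤ 336 * (ell P * ρ) * ∑ σ, dist1 (stairHol V y (off r) σ) := hE
  have hE'' : ‖Cv - 1 - Mn‖ ≤ 336 * (ell P * ρ) * permMass V y r := hE'.trans (mul_le_mul_of_nonneg_left hdist (by positivity))
  have hsplit : Cv - 1 - permMeanLin V y r = (Cv - 1 - Mn) + (Mn - permMeanLin V y r) := by abel
  have h1 : ‖Cv - 1 - permMeanLin V y r‖ ≤ 337 * (ell P * ρ) * permMass V y r := by
    rw [hsplit]; refine (norm_add_le _ _).trans ?_; linarith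
  refine ⟨h1, ?_⟩
  have hMn1 : ‖Mn‖ ≤ permMass V y r := by
    rw [hMn, norm_smul, hcn]
    calc (Fintype.card (Equiv.Perm (Fin P.d)) : ℝ)⁻¹ * ‖∑ σ, ((((stairHol V y (off r) σ : Matrix.specialUnitaryGroup n ℂ)) : MatA n) - 1)‖
        ≤ 1 * permMass V y r := by
          refine mul_le_mul hcle ((norm_sum_le _ _).trans (hdist.trans' (Finset.sum_le_sum fun σ _ => ?_))) (norm_nonneg _)
            zero_le_one
          rw [← dist1_eq_norm]
      _ = permMass V y r := one_mul _
  have hFed : ell P * ρ ≤ 1 / 200 := by have := deltaFed_le (n := n); linarith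
  have hsplit2 : Cv - 1 = (Cv - 1 - Mn) + Mn := by abel
  have hprod : 336 * (ell P * ρ) * permMass V y r ≤ 2 * permMass V y r := by nlinarith [permMass_nonneg V y r]
  rw [hsplit2]
  refine (norm_add_le _ _).trans ?_
  linarith

/-- THE REVERSED AVERAGED CONTOUR VARIABLE `U(x′, c₊)` TO SECOND ORDER: `‖U(x′,c₊) − 1 + permMeanLin(c₊)‖ ≤ 339ℓρ·permMass` and
`‖U(x′,c₊) − 1‖ ≤ 3·permMass`. [cite: Balaban1987RG1, (0.12) p.254] -/
theorem cVarRev_estimates (hρ : 0 ≤ ρ) (hV : ∀ b, dist1 (V b) ≤ ρ) (hF : 2 * (ell P * ρ) < deltaFed n) (y : Site P (j + 1)) (r : Pt P) :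
    ‖((cVarRev (federbushSU (n := n)) V y (off r) : Matrix.specialUnitaryGroup n ℂ) : MatA n) - 1 - (-permMeanLin V y r)‖
        ≤ 339 * (ell P * ρ) * permMass V y r ∧
      ‖((cVarRev (federbushSU (n := n)) V y (off r) : Matrix.specialUnitaryGroup n ℂ) : MatA n) - 1‖ ≤ 3 * permMass V y r := by
  have hη0 : 0 ≤ ell P * ρ := by positivity
  have hmass : ∀ σ, walkMass V (walk (emb y) (stairWord σ (off r))) ≤ ell P * ρ := fun σ => walkMass_stair_le V hρ hV y ⟨r, σ, 1⟩
  have hW : ∀ σ, dist1 (stairHol V y (off r) σ)⁻¹ ≤ ell P * ρ := fun σ => by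
    rw [GaugeGroup.dist1_inv]; exact (dist1_holAt_le_walkMass V _).trans (hmass σ)
  have hE := norm_fedAvg_sub_one_sub_mean_le (fun σ => (stairHol V y (off r) σ)⁻¹) hF hW
  have hdist : ∑ σ, dist1 (stairHol V y (off r) σ)⁻¹ ≤ permMass V y r :=
    Finset.sum_le_sum fun σ _ => by rw [GaugeGroup.dist1_inv]; exact dist1_holAt_le_walkMass V _
  set c : ℂ := ((Fintype.card (Equiv.Perm (Fin P.d)) : ℂ))⁻¹ with hc
  have hcn : ‖c‖ = (Fintype.card (Equiv.Perm (Fin P.d)) : ℝ)⁻¹ := by rw [hc, norm_inv, Complex.norm_natCast]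
  have hcle : (Fintype.card (Equiv.Perm (Fin P.d)) : ℝ)⁻¹ ≤ 1 := inv_le_one_of_one_le₀ (one_le_cardPerm P)
  -- `mean((g⁻¹ − 1)) + permMeanLin = mean[(g⁻¹ − 1) + (g − 1)] − mean[(g − 1) − Lin]`
  have hterm : ∀ σ, ‖((((stairHol V y (off r) σ)⁻¹ : Matrix.specialUnitaryGroup n ℂ)) : MatA n) - 1
      + walkLin V (walk (emb y) (stairWord σ (off r)))‖ ≤ 2 * (ell P * ρ) * walkMass V (walk (emb y) (stairWord σ (off r))) := fun σ => by
    have hinv := norm_coe_inv_sub_one_add_le (stairHol V y (off r) σ)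
    have hlin := norm_hol_sub_one_sub_walkLin_le V (walk (emb y) (stairWord σ (off r)))
    have hm := hmass σ
    have hm0 := walkMass_nonneg V (walk (emb y) (stairWord σ (off r)))
    have hg : ‖((stairHol V y (off r) σ : Matrix.specialUnitaryGroup n ℂ) : MatA n) - 1‖ ≤ walkMass V (walk (emb y) (stairWord σ (off r))) := by
      rw [← dist1_eq_norm]; exact dist1_holAt_le_walkMass V _
    have hsq : ‖((stairHol V y (off r) σ : Matrix.specialUnitaryGroup n ℂ) : MatA n) - 1‖ ^ 2
        ≤ (ell P * ρ) * walkMass V (walk (emb y) (stairWord σ (off r))) := by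
      rw [pow_two]; exact mul_le_mul (hg.trans hm) hg (norm_nonneg _) hη0
    have e : ((((stairHol V y (off r) σ)⁻¹ : Matrix.specialUnitaryGroup n ℂ)) : MatA n) - 1
        + walkLin V (walk (emb y) (stairWord σ (off r)))
        = (((((stairHol V y (off r) σ)⁻¹ : Matrix.specialUnitaryGroup n ℂ)) : MatA n) - 1
            + (((stairHol V y (off r) σ : Matrix.specialUnitaryGroup n ℂ) : MatA n) - 1))
          - ((((stairHol V y (off r) σ : Matrix.specialUnitaryGroup n ℂ) : MatA n) - 1)
            - walkLin V (walk (emb y) (stairWord σ (off r)))) := by abel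
    rw [e]
    refine (norm_sub_le _ _).trans ?_
    have : walkMass V (walk (emb y) (stairWord σ (off r))) ^ 2 ≤ (ell P * ρ) * walkMass V (walk (emb y) (stairWord σ (off r))) := by
      rw [pow_two]; exact mul_le_mul_of_nonneg_right hm hm0
    unfold stairHol at *
    linarith
  have hlin : ‖c • ∑ σ, (((((stairHol V y (off r) σ)⁻¹ : Matrix.specialUnitaryGroup n ℂ)) : MatA n) - 1) - (-permMeanLin V y r)‖
      ≤ 2 * (ell P * ρ) * permMass V y r := by
    rw [permMeanLin, ← hc, sub_neg_eq_add, ← smul_add, ← Finset.sum_add_distrib, norm_smul, hcn]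
    have hs : ‖∑ σ, (((((stairHol V y (off r) σ)⁻¹ : Matrix.specialUnitaryGroup n ℂ)) : MatA n) - 1
        + walkLin V (walk (emb y) (stairWord σ (off r))))‖ ≤ 2 * (ell P * ρ) * permMass V y r := by
      refine (norm_sum_le _ _).trans ?_
      rw [permMass, Finset.mul_sum]
      exact Finset.sum_le_sum fun σ _ => hterm σ
    calc (Fintype.card (Equiv.Perm (Fin P.d)) : ℝ)⁻¹ * ‖∑ σ, (((((stairHol V y (off r) σ)⁻¹ : Matrix.specialUnitaryGroup n ℂ)) : MatA n) - 1
            + walkLin V (walk (emb y) (stairWord σ (off r))))‖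
        ≤ 1 * (2 * (ell P * ρ) * permMass V y r) := mul_le_mul hcle hs (norm_nonneg _) zero_le_one
      _ = 2 * (ell P * ρ) * permMass V y r := one_mul _
  set Cv : MatA n := ((cVarRev (federbushSU (n := n)) V y (off r) : Matrix.specialUnitaryGroup n ℂ) : MatA n) with hCv
  set Mn : MatA n := c • ∑ σ, (((((stairHol V y (off r) σ)⁻¹ : Matrix.specialUnitaryGroup n ℂ)) : MatA n) - 1) with hMn
  have hE'' : ‖Cv - 1 - Mn‖ ≤ 336 * (ell P * ρ) * permMass V y r :=
    (show ‖Cv - 1 - Mn‖ ≤ 336 * (ell P * ρ) * ∑ σ, dist1 (stairHol V y (off r) σ)⁻¹ from hE).trans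
      (mul_le_mul_of_nonneg_left hdist (by positivity))
  have hsplit : Cv - 1 - (-permMeanLin V y r) = (Cv - 1 - Mn) + (Mn - (-permMeanLin V y r)) := by abel
  have h1 : ‖Cv - 1 - (-permMeanLin V y r)‖ ≤ 339 * (ell P * ρ) * permMass V y r := by
    rw [hsplit]; refine (norm_add_le _ _).trans ?_; nlinarith [permMass_nonneg V y r]
  refine ⟨h1, ?_⟩
  have hMn1 : ‖Mn‖ ≤ permMass V y r := by
    rw [hMn, norm_smul, hcn]
    calc (Fintype.card (Equiv.Perm (Fin P.d)) : ℝ)⁻¹ * ‖∑ σ, (((((stairHol V y (off r) σ)⁻¹ : Matrix.specialUnitaryGroup n ℂ)) : MatA n) - 1)‖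
        ≤ 1 * permMass V y r := by
          refine mul_le_mul hcle ((norm_sum_le _ _).trans (hdist.trans' (Finset.sum_le_sum fun σ _ => ?_))) (norm_nonneg _)
            zero_le_one
          rw [← dist1_eq_norm]
      _ = permMass V y r := one_mul _
  have hFed : ell P * ρ ≤ 1 / 200 := by have := deltaFed_le (n := n); linarith
  have hsplit2 : Cv - 1 = (Cv - 1 - Mn) + Mn := by abel
  have hprod : 336 * (ell P * ρ) * permMass V y r ≤ 2 * permMass V y r := by nlinarith [permMass_nonneg V y r]
  rw [hsplit2]
  refine (norm_add_le _ _).trans ?_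
  linarith

/-- THE TRANSPORTED BOND TO SECOND ORDER (two-level parametrisation `offSite`). [folklore] -/
theorem seg_estimates (hρ : 0 ≤ ρ) (hV : ∀ b, dist1 (V b) ≤ ρ) (c : PBond P (j + 1)) (r : Pt P) :
    ‖((seg V c (off r) : Matrix.specialUnitaryGroup n ℂ) : MatA n) - 1 - segLin V c r‖ ≤ (ell P * ρ) * segMass₁ V c r ∧
      ‖((seg V c (off r) : Matrix.specialUnitaryGroup n ℂ) : MatA n) - 1‖ ≤ segMass₁ V c r := by
  unfold seg segLin segMass₁
  rw [offSite_off]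
  refine ⟨(norm_hol_sub_one_sub_walkLin_le V _).trans ?_, ?_⟩
  · rw [pow_two]
    exact mul_le_mul_of_nonneg_right (walkMass_ax_le V hρ hV _ _) (walkMass_nonneg V _)
  · rw [← dist1_eq_norm]; exact dist1_holAt_le_walkMass V _

/-- THE INVERSE SEGMENT `U(c)⁻¹` TO SECOND ORDER. [folklore] -/
theorem axInv_estimates (hρ : 0 ≤ ρ) (hV : ∀ b, dist1 (V b) ≤ ρ) (c : PBond P (j + 1)) :
    ‖(((axialAvg V c)⁻¹ : Matrix.specialUnitaryGroup n ℂ) : MatA n) - 1 - (-axLin V c)‖ ≤ 2 * (ell P * ρ) * axMass V c ∧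
      ‖(((axialAvg V c)⁻¹ : Matrix.specialUnitaryGroup n ℂ) : MatA n) - 1‖ ≤ axMass V c := by
  obtain ⟨d3, f3⟩ := ax_estimates V hρ hV c
  have hinv := norm_coe_inv_sub_one_add_le (axialAvg V c)
  have hm : axMass V c ≤ ell P * ρ := walkMass_ax_le V hρ hV _ _
  have hm0 : 0 ≤ axMass V c := walkMass_nonneg V _
  refine ⟨?_, by rw [norm_coe_inv_sub_one]; exact f3⟩
  have e : (((axialAvg V c)⁻¹ : Matrix.specialUnitaryGroup n ℂ) : MatA n) - 1 - (-axLin V c)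
      = ((((axialAvg V c)⁻¹ : Matrix.specialUnitaryGroup n ℂ) : MatA n) - 1 + (((axialAvg V c : Matrix.specialUnitaryGroup n ℂ) : MatA n) - 1))
        - ((((axialAvg V c : Matrix.specialUnitaryGroup n ℂ) : MatA n) - 1) - axLin V c) := by abel
  rw [e]
  refine (norm_sub_le _ _).trans ?_
  have hsq : ‖((axialAvg V c : Matrix.specialUnitaryGroup n ℂ) : MatA n) - 1‖ ^ 2 ≤ (ell P * ρ) * axMass V c := by
    rw [pow_two]; exact mul_le_mul (f3.trans hm) f3 (norm_nonneg _) (by positivity)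
  linarith

end Factors

/-! ## §4 The loop variable of (0.12) to second order -/

/-- `|S_d|` as a real (the number of orderings; the inner family size). [folklore] -/
def Dn (P : Params) : ℝ := Fintype.card (Equiv.Perm (Fin P.d))

/-- `1 ≤ |S_d|`. [folklore] -/
theorem one_le_Dn (P : Params) : 1 ≤ Dn P := one_le_cardPerm P

/-- **THE LOOP VARIABLE OF (0.12) TO SECOND ORDER**: `‖W_r − 1 − loopLin₂(c, r)‖ ≤ 366·|S_d|·ℓρ·loopRem₂(c, r)` and
`dist1 W_r ≤ 3·loopRem₂(c, r)` (four unit-norm factors `U(c₋,x)`, `U([x,x′])`, `U(x′,c₊)`, `U(c)⁻¹`, each to second order). [folklore] -/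
theorem loopHol₂_estimates (V : GaugeField P j (Matrix.specialUnitaryGroup n ℂ)) {ρ : ℝ} (hρ : 0 ≤ ρ) (hV : ∀ b, dist1 (V b) ≤ ρ)
    (hF : 2 * (ell P * ρ) < deltaFed n) (c : PBond P (j + 1)) (r : Pt P) :
    ‖((loopHol₂ (federbushSU (n := n)) V c r : Matrix.specialUnitaryGroup n ℂ) : MatA n) - 1 - loopLin₂ V c r‖
        ≤ 366 * Dn P * (ell P * ρ) * loopRem₂ V c r ∧
      dist1 (loopHol₂ (federbushSU (n := n)) V c r) ≤ 3 * loopRem₂ V c r := by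
  set η : ℝ := ell P * ρ with hη
  have hη0 : 0 ≤ η := by positivity
  have hD := one_le_Dn P
  obtain ⟨d1, f1⟩ := cVar_estimates V hρ hV hF c.src r
  obtain ⟨d2, f2⟩ := seg_estimates V hρ hV c r
  obtain ⟨d3, f3⟩ := cVarRev_estimates V hρ hV hF c.tgt r
  obtain ⟨d4, f4⟩ := axInv_estimates V hρ hV c
  have hs1 : permMass V c.src r ≤ Dn P * η := permMass_le V hρ hV c.src r
  have hs2 : segMass₁ V c r ≤ η := walkMass_ax_le V hρ hV _ _
  have hs3 : permMass V c.tgt r ≤ Dn P * η := permMass_le V hρ hV c.tgt r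
  have hs4 : axMass V c ≤ η := walkMass_ax_le V hρ hV _ _
  have hp1 := permMass_nonneg V c.src r
  have hp2 : 0 ≤ segMass₁ V c r := walkMass_nonneg V _
  have hp3 := permMass_nonneg V c.tgt r
  have hp4 : 0 ≤ axMass V c := walkMass_nonneg V _
  have hDη : η ≤ Dn P * η := by nlinarith
  have key := norm_prod4_sub_one_sub_le_lin (Φ := 3 * (Dn P * η))
    (le_of_eq (norm_coe_eq_one _)) (le_of_eq (norm_coe_eq_one _)) f1 f2 f3 f4
    (by linarith) (by linarith) (by linarith) (by linarith) d1 d2 d3 d4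
  have hprod : ((loopHol₂ (federbushSU (n := n)) V c r : Matrix.specialUnitaryGroup n ℂ) : MatA n)
      = ((cVar (federbushSU (n := n)) V c.src (off r) : Matrix.specialUnitaryGroup n ℂ) : MatA n)
        * ((seg V c (off r) : Matrix.specialUnitaryGroup n ℂ) : MatA n)
        * ((cVarRev (federbushSU (n := n)) V c.tgt (off r) : Matrix.specialUnitaryGroup n ℂ) : MatA n)
        * (((axialAvg V c)⁻¹ : Matrix.specialUnitaryGroup n ℂ) : MatA n) := by
    simp only [loopHol₂, Submonoid.coe_mul]
  have hlin : permMeanLin V c.src r + segLin V c r + -permMeanLin V c.tgt r + -axLin V c = loopLin₂ V c r := by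
    rw [loopLin₂]; abel
  refine ⟨?_, ?_⟩
  · rw [hprod, ← hlin]
    refine key.trans ?_
    rw [loopRem₂]
    nlinarith [mul_nonneg hη0 hp1, mul_nonneg hη0 hp2, mul_nonneg hη0 hp3, mul_nonneg hη0 hp4,
      mul_nonneg (mul_nonneg (by linarith : (0:ℝ) ≤ Dn P - 1) hη0) hp1,
      mul_nonneg (mul_nonneg (by linarith : (0:ℝ) ≤ Dn P - 1) hη0) hp2,
      mul_nonneg (mul_nonneg (by linarith : (0:ℝ) ≤ Dn P - 1) hη0) hp3,
      mul_nonneg (mul_nonneg (by linarith : (0:ℝ) ≤ Dn P - 1) hη0) hp4]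
  · unfold loopHol₂
    calc dist1 (cVar (federbushSU (n := n)) V c.src (off r) * seg V c (off r) * cVarRev (federbushSU (n := n)) V c.tgt (off r)
          * (axialAvg V c)⁻¹)
        ≤ dist1 (cVar (federbushSU (n := n)) V c.src (off r) * seg V c (off r) * cVarRev (federbushSU (n := n)) V c.tgt (off r))
          + dist1 (axialAvg V c)⁻¹ := GaugeGroup.dist1_mul_le _ _
      _ ≤ dist1 (cVar (federbushSU (n := n)) V c.src (off r) * seg V c (off r))
          + dist1 (cVarRev (federbushSU (n := n)) V c.tgt (off r)) + dist1 (axialAvg V c)⁻¹ := by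
          gcongr; exact GaugeGroup.dist1_mul_le _ _
      _ ≤ dist1 (cVar (federbushSU (n := n)) V c.src (off r)) + dist1 (seg V c (off r))
          + dist1 (cVarRev (federbushSU (n := n)) V c.tgt (off r)) + dist1 (axialAvg V c)⁻¹ := by
          gcongr; exact GaugeGroup.dist1_mul_le _ _
      _ ≤ 3 * loopRem₂ V c r := by
          rw [dist1_eq_norm, dist1_eq_norm, dist1_eq_norm, dist1_eq_norm, loopRem₂]
          linarith

end SUN

end Summit.QuantumFields.BalabanUV.T4Continuum.Spine.NE7

end
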